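/-
Copyright: statement-level skeleton of a published paper (lit-balaban cell, Phase-2 proof seat p39 gen 17). No proof claims
beyond what the kernel checks below.
-/
import Literature.MathematicalPhysics.QuantumFieldTheory.Balaban1983to89.B3Eq316DifferenceKernelBounds
import Literature.MathematicalPhysics.QuantumFieldTheory.Balaban1983to89.B3CxiTadpoleLimit

/-!
# B3 — T. Bałaban, *(Higgs)₂,₃ quantum fields in a finite volume. III. Renormalization*, CMP **88** (1983) 411–445
[Balaban1983Higgs3], p. 438 [PDF 28]: **"ηG_k(x,x) is convergent to some finite constant as η → 0" ON THE PRINT'S OWN CARRIER** —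
the coincident-point value of the INFINITE-LATTICE zero-field propagator `G_k(0) = G_k(ηℤ³, 0)` of p. 433 (gen 9's `GxiL`,
`η = L^{−k}`), times one power of the spacing, converges as `k → ∞` to the free-propagator constant
`K₃ = (2π)^{−3}∫_{|q_μ|≤π} dq/Δ¹(q) ∈ [1/12, 3(π+1)/(4π)]`, uniformly in the site and in the window, at rate `O(η)`

statement-level skeleton of published theorems with citation tags; proofs where landed; nothing here is a claim about
the Yang–Mills mass gap

PDF held: `paper:balaban1983-higgs-2-3-quantum-fields-finite-volume` (journal page = PDF page + 410); p. 438 [PDF 28] and p. 433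
[PDF 23] read in the OCR text (`p0028.txt`, `p0023.txt` of `lit read`).

CITATION HEADER (lean-in-tree rule).  Part of the lit-balaban TYPED SKELETON (HOME `run/shared/lean/pub/lit-balaban/`), Phase 2,
proof seat p39 generation 17 (file 2 of the generation).  Row **B3.Eq3.21-3.24** of `HOME/lit-balaban-r15/ROWS-B3.md` (fold owner
r15), the p. 438 sentence on the first graph of (3.21).  The TORUS reading is p20 g8's `B3GkTadpoleLimitZeroTorus`
(`eta_mul_G0xi_diag_tendsto`: the zero-field torus propagator, uniformly in the volume); under the fold owner's correction ROWS
v1.207 (*"print's carrier for (3.4)–(3.38) is the zero-field infinite-lattice scalar propagator G_k(0) = G_k(ηℤ^d,0)"*) this file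
is its twin AT THE PRINTED CARRIER, and it is shorter: on `ℤ³` there is no torus ↔ `ℤ³` coset comparison — the (3.16) split
`G^ξ_k(0) = C^ξ + M` at the diagonal and gen 9's uniform bound `|M(y,y′)| ≤ K` (`B3Eq316DifferenceKernelBounds.exists_bounds`,
*"the point of (3.16)"*) give `|ηG_k(y,y) − ηC^η(0)| ≤ K·η` at once, and p20 g4's `B3CxiTadpoleLimit.tendsto_xi_mul_Cxi_zero_three`
(`ξC^ξ(0) → K₃`) finishes.  Used BY NAME, nothing restated: `GxiL`/`MxiL`/`xiOf` (gen 9), `exists_bounds` (gen 9),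
`tendsto_xi_mul_Cxi_zero_three`/`tadpoleConst_mem_Icc` (p20 g4).

THE PRINTED TEXT (verbatim, p. 438).  *"We have to consider another class of graphs with two external scalar field legs, the
graphs with one leg differentiated. There are only two such graphs: (3.21). The expression corresponding to the first graph is
in fact convergent, because ηG_k(x,x) is convergent to some finite constant as η → 0."*  Here `η = L^{−k}` ((1.1) p. 412), so
`η → 0` is `k → ∞`; `G_k` is, after the p. 433 reductions (*"with the scalar field propagator equal to G_k(0)"*), the zero-field
propagator of the infinite lattice `ηℤ³`, whose kernel w.r.t. the volume element `η³` is gen 9's `GxiL ℓ k a m²` (unit blocks,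
`L^k` fine sites per block; the paper's `ηG_k(x,x)` is `xiOf ℓ k * GxiL ℓ k a m2 x x`).

WHAT IS PROVED (`d = 3`; `L = ℓ + 1 ≥ 2`; window `a ∈ [a₋,a₊]`, `a₋ > 0`, `m² ∈ [0,m²₊]`; `K₃ = (2π)^{−3}∫_{bzBox}(Δ¹)^{−1}`).
* §1 `GxiL_diag_eq`: `G^η_k(0;y,y) = C^η(0) + M(y,y)` (the (3.16) split at the diagonal; definition of `MxiL`).
* §2 **`abs_eta_mul_GxiL_diag_sub_le`**: `∃ C ∀ k ≥ 1 ∀ window ∀ y`, `|ηG_k(y,y) − ηC^η(0)| ≤ C·η` (gen 9's `|M| ≤ K`).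
* §3 `xiOf_eq_inv_pow`, `tendsto_xiOf_nhdsWithin`, `exists_xiOf_lt`: `η = L^{−k} → 0⁺`.
* §4 **`eta_mul_GxiL_diag_tendsto`** — THE SENTENCE, uniformly: `∀ e > 0 ∃ k₀ ∀ k ≥ k₀ ∀ window ∀ y`, `|ηG_k(y,y) − K₃| < e`;
  `eta_mul_GxiL_diag_tendsto_atTop` (the `Filter.Tendsto` form at a fixed window point and site); **`eta_mul_GxiL_diag_convergent`**
  — the printed shape *"convergent to SOME finite constant"*, with `K ∈ [1/12, 3(π+1)/(4π)]` (p20's `tadpoleConst_mem_Icc`).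
HONEST SCOPE: `d = 3` (in `d = 2` the statement changes: the constant is `0` and `ηG_k(x,x) = O(η log η^{−1})`, cf. p27 g30
`B3TadpoleZeroTorusTwoDim` on the torus; the lattice `d = 2` twin needs `d = 2` laws for `G_k(ηℤ²,0)`, not in the tree); zero
external field, unit blocks (the printed §3 case); the expression of the first graph of (3.21) as a graph object (p18's torus
`expr321a`) is not re-typed on the lattice — what is proved is its vertex function `ηG_k(x,x)`.  Mathlib + the cited tree files only;
theorems only, no definitions, no named facts; standard axioms.  Unit `lit-balaban-p39-g17` (Phase-2 proof seat p39, gen 17),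
HOME `run/shared/lean/pub/lit-balaban/`, 2026-08-23.
-/

open Filter Set
open scoped Topology

namespace Literature.MathematicalPhysics.QuantumFieldTheory.Balaban1983to89.B3GkTadpoleLimitZeroLattice

open B3Sect3VectorSelfEnergy (ZSite Cxi bzBox lapSymbol)
open B3Eq316ResolventZeroLattice (xiOf GxiL MxiL xiOf_pos xiOf_le_one)
open B3Eq316DifferenceKernelBounds (exists_bounds)
open B3CxiTadpoleLimit (tendsto_xi_mul_Cxi_zero_three tadpoleConst_mem_Icc)
open _root_.Filter _root_.Set

noncomputable section

variable {ℓ : ℕ}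

/-! ## §1 The (3.16) split at the diagonal -/

/-- kernel: `G^η_k(0;y,y) = C^η(0) + M(y,y)` — the resolvent split of p. 437 (`B3Eq316ResolventZeroLattice.MxiL`) at coinciding
points. [cite: Balaban1983Higgs3, (3.21) p.438] -/
theorem GxiL_diag_eq (ℓ k : ℕ) (a m2 : ℝ) (y : ZSite 3) :
    GxiL ℓ k a m2 y y = Cxi 3 (xiOf ℓ k) 0 + MxiL ℓ k a m2 y y := by
  simp only [MxiL, sub_self]
  ring

/-! ## §2 The `O(η)` comparison with the free tadpole -/

/-- **`|ηG_k(y,y) − ηC^η(0)| ≤ C·η` ON THE INFINITE LATTICE**, for every `k ≥ 1`, every window point and every site, with one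
constant `C` (on `L` and the window): the difference kernel `M = G^ξ_k(0) − C^ξ` is uniformly bounded (gen 9's
`B3Eq316DifferenceKernelBounds.exists_bounds`, *"the point of (3.16)"*), whereas each term is `~ η^{−1}`.
[cite: Balaban1983Higgs3, (3.21) p.438] -/
theorem abs_eta_mul_GxiL_diag_sub_le (hℓ : 1 ≤ ℓ) (amin aplus m2plus : ℝ) (ha : 0 < amin) :
    ∃ C : ℝ, 0 < C ∧ ∀ (k : ℕ), 1 ≤ k → ∀ (a m2 : ℝ), amin ≤ a → a ≤ aplus → 0 ≤ m2 → m2 ≤ m2plus →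
      ∀ y : ZSite 3, |xiOf ℓ k * GxiL ℓ k a m2 y y - xiOf ℓ k * Cxi 3 (xiOf ℓ k) 0| ≤ C * xiOf ℓ k := by
  obtain ⟨δ, C, K, -, -, -, hK, hB⟩ := exists_bounds hℓ amin aplus m2plus ha
  refine ⟨K, hK, ?_⟩
  intro k hk a m2 ha1 ha2 hm1 hm2 y
  obtain ⟨-, bM, -⟩ := hB k hk a m2 ha1 ha2 hm1 hm2
  have hξ := xiOf_pos ℓ k
  rw [GxiL_diag_eq, mul_add, add_sub_cancel_left, abs_mul, abs_of_pos hξ, mul_comm]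
  exact mul_le_mul_of_nonneg_right (bM y y) hξ.le

/-! ## §3 `η = L^{−k} → 0⁺` -/

/-- kernel: `η = L^{−k} = (1/L)^k`. [cite: Balaban1983Higgs3, (1.1) p.412] -/
theorem xiOf_eq_inv_pow (ℓ k : ℕ) : xiOf ℓ k = (((ℓ : ℝ) + 1)⁻¹) ^ k := by
  rw [xiOf, inv_pow]

/-- kernel: `η = L^{−k} → 0⁺` as `k → ∞` (`L ≥ 2`). [cite: Balaban1983Higgs3, (3.21) p.438] -/
theorem tendsto_xiOf_nhdsWithin (hℓ : 1 ≤ ℓ) : Tendsto (fun k => xiOf ℓ k) atTop (𝓝[>] 0) := by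
  have hL : (1 : ℝ) < (ℓ : ℝ) + 1 := by
    have : (1 : ℝ) ≤ (ℓ : ℝ) := by exact_mod_cast hℓ
    linarith
  have h0 : 0 ≤ ((ℓ : ℝ) + 1)⁻¹ := by positivity
  have h1 : ((ℓ : ℝ) + 1)⁻¹ < 1 := inv_lt_one_of_one_lt₀ hL
  have ht : Tendsto (fun k => xiOf ℓ k) atTop (𝓝 0) := by
    simp only [xiOf_eq_inv_pow]
    exact tendsto_pow_atTop_nhds_zero_of_lt_one h0 h1
  refine tendsto_nhdsWithin_iff.2 ⟨ht, Eventually.of_forall fun k => ?_⟩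
  exact xiOf_pos ℓ k

/-- kernel: for every `θ > 0` there is `k₀` with `η = L^{−k} < θ` for all `k ≥ k₀`. [cite: Balaban1983Higgs3, (3.21) p.438] -/
theorem exists_xiOf_lt (hℓ : 1 ≤ ℓ) {θ : ℝ} (hθ : 0 < θ) : ∃ k₀ : ℕ, ∀ k : ℕ, k₀ ≤ k → xiOf ℓ k < θ := by
  have h := (tendsto_nhdsWithin_iff.1 (tendsto_xiOf_nhdsWithin hℓ)).1
  have hev : ∀ᶠ k in atTop, xiOf ℓ k < θ := by
    have := h (Iio_mem_nhds hθ)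
    filter_upwards [this] with k hk using hk
  obtain ⟨k₀, hk₀⟩ := eventually_atTop.1 hev
  exact ⟨k₀, hk₀⟩

/-! ## §4 The sentence: `ηG_k(x,x) → K₃` as `η → 0`, uniformly in the site and the window -/

/-- **p. 438 [PDF 28], "ηG_k(x,x) IS CONVERGENT TO SOME FINITE CONSTANT AS η → 0" — PROVED ON THE PRINT'S CARRIER**, uniformly:
for the infinite-lattice zero-field propagator `G_k(0) = G_k(ηℤ³,0)` (`η = L^{−k}`, `d = 3`) and every `e > 0` there is `k₀` such
that `|ηG_k(y,y) − K₃| < e` for EVERY `k ≥ k₀`, every window point `(a, m²)` and every site `y`, where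
`K₃ = (2π)^{−3}∫_{|q_μ|≤π} dq/Δ¹(q)` is the free-propagator constant of p20's `tendsto_xi_mul_Cxi_zero_three`.
[cite: Balaban1983Higgs3, (3.21) p.438] -/
theorem eta_mul_GxiL_diag_tendsto (hℓ : 1 ≤ ℓ) (amin aplus m2plus : ℝ) (ha : 0 < amin) {e : ℝ} (he : 0 < e) :
    ∃ k₀ : ℕ, ∀ (k : ℕ), k₀ ≤ k → ∀ (a m2 : ℝ), amin ≤ a → a ≤ aplus → 0 ≤ m2 → m2 ≤ m2plus → ∀ y : ZSite 3,
      |xiOf ℓ k * GxiL ℓ k a m2 y y - (2 * Real.pi)⁻¹ ^ 3 * ∫ q in bzBox 3 1, (lapSymbol 3 1 q)⁻¹| < e := by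
  obtain ⟨C, hC, HA⟩ := abs_eta_mul_GxiL_diag_sub_le hℓ amin aplus m2plus ha
  -- the free tadpole is within `e/2` of `K₃` for small `ξ`
  have hev : ∀ᶠ ξ in 𝓝[>] (0 : ℝ),
      |ξ * Cxi 3 ξ 0 - (2 * Real.pi)⁻¹ ^ 3 * ∫ q in bzBox 3 1, (lapSymbol 3 1 q)⁻¹| < e / 2 := by
    have h := tendsto_xi_mul_Cxi_zero_three (Metric.ball_mem_nhds _ (half_pos he))
    filter_upwards [h] with ξ hξ
    rw [Set.mem_preimage, Metric.mem_ball, Real.dist_eq] at hξ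
    exact hξ
  have hev' : ∀ᶠ k in atTop, |xiOf ℓ k * Cxi 3 (xiOf ℓ k) 0 -
      (2 * Real.pi)⁻¹ ^ 3 * ∫ q in bzBox 3 1, (lapSymbol 3 1 q)⁻¹| < e / 2 :=
    (tendsto_xiOf_nhdsWithin hℓ).eventually hev
  obtain ⟨k₁, hk₁⟩ := eventually_atTop.1 hev'
  obtain ⟨k₂, hk₂⟩ := exists_xiOf_lt hℓ (show 0 < e / 2 / C by positivity)
  refine ⟨max 1 (max k₁ k₂), fun k hk a m2 ha1 ha2 hm1 hm2 y => ?_⟩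
  have hk1 : 1 ≤ k := le_trans (le_max_left _ _) hk
  have hkk₁ : k₁ ≤ k := le_trans ((le_max_left _ _).trans (le_max_right _ _)) hk
  have hkk₂ : k₂ ≤ k := le_trans ((le_max_right _ _).trans (le_max_right _ _)) hk
  have h1 := HA k hk1 a m2 ha1 ha2 hm1 hm2 y
  have h2 := hk₁ k hkk₁
  have h3 : C * xiOf ℓ k < e / 2 := by
    have := hk₂ k hkk₂
    rwa [lt_div_iff₀ hC, mul_comm] at this
  calc |xiOf ℓ k * GxiL ℓ k a m2 y y - (2 * Real.pi)⁻¹ ^ 3 * ∫ q in bzBox 3 1, (lapSymbol 3 1 q)⁻¹|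
      ≤ |xiOf ℓ k * GxiL ℓ k a m2 y y - xiOf ℓ k * Cxi 3 (xiOf ℓ k) 0| +
          |xiOf ℓ k * Cxi 3 (xiOf ℓ k) 0 - (2 * Real.pi)⁻¹ ^ 3 * ∫ q in bzBox 3 1, (lapSymbol 3 1 q)⁻¹| :=
        abs_sub_le _ _ _
    _ < e / 2 + e / 2 := add_lt_add (h1.trans_lt h3) h2
    _ = e := by ring

/-- **The same at a fixed window point and site, as a limit**: `ηG_k(y,y) → K₃` (`k → ∞`). [cite: Balaban1983Higgs3, (3.21) p.438] -/
theorem eta_mul_GxiL_diag_tendsto_atTop (hℓ : 1 ≤ ℓ) {a m2 : ℝ} (ha : 0 < a) (hm : 0 ≤ m2) (y : ZSite 3) :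
    Tendsto (fun k => xiOf ℓ k * GxiL ℓ k a m2 y y) atTop
      (𝓝 ((2 * Real.pi)⁻¹ ^ 3 * ∫ q in bzBox 3 1, (lapSymbol 3 1 q)⁻¹)) := by
  refine Metric.tendsto_atTop.2 fun e he => ?_
  obtain ⟨k₀, h⟩ := eta_mul_GxiL_diag_tendsto hℓ a a m2 ha he
  exact ⟨k₀, fun k hk => by rw [Real.dist_eq]; exact h k hk a m2 le_rfl le_rfl hm le_rfl y⟩

/-- **p. 438, THE PRINTED SHAPE** — *"ηG_k(x,x) is convergent to some finite constant as η → 0"*, for `G_k(0) = G_k(ηℤ³,0)`: there is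
a real constant `K`, in fact `K ∈ [1/12, 3(π+1)/(4π)]` (p20's `tadpoleConst_mem_Icc`), such that for every `e > 0` there is `k₀`
with `|ηG_k(y,y) − K| < e` for all `k ≥ k₀`, window points and sites. [cite: Balaban1983Higgs3, (3.21) p.438] -/
theorem eta_mul_GxiL_diag_convergent (hℓ : 1 ≤ ℓ) (amin aplus m2plus : ℝ) (ha : 0 < amin) :
    ∃ K : ℝ, K ∈ Set.Icc (1 / 12 : ℝ) (3 * (Real.pi + 1) / (4 * Real.pi)) ∧
      ∀ e : ℝ, 0 < e → ∃ k₀ : ℕ, ∀ (k : ℕ), k₀ ≤ k → ∀ (a m2 : ℝ), amin ≤ a → a ≤ aplus → 0 ≤ m2 → m2 ≤ m2plus →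
        ∀ y : ZSite 3, |xiOf ℓ k * GxiL ℓ k a m2 y y - K| < e :=
  ⟨_, tadpoleConst_mem_Icc, fun _ he => eta_mul_GxiL_diag_tendsto hℓ amin aplus m2plus ha he⟩

/-- **"The expression corresponding to the first graph is in fact convergent"** in the quantitative form used downstream: the
vertex function of the first graph of (3.21), `ηG_k(x,x)·g(x)`, is within `C·η` of the LOCAL vertex `ηC^η(0)·g(x)` built on the free
tadpole, for every localization `|g| ≤ 1`, uniformly in `k ≥ 1`, the window and `x`. [cite: Balaban1983Higgs3, (3.21) p.438] -/
theorem abs_vertex321a_sub_free_le (hℓ : 1 ≤ ℓ) (amin aplus m2plus : ℝ) (ha : 0 < amin) :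
    ∃ C : ℝ, 0 < C ∧ ∀ (k : ℕ), 1 ≤ k → ∀ (a m2 : ℝ), amin ≤ a → a ≤ aplus → 0 ≤ m2 → m2 ≤ m2plus →
      ∀ (g : ZSite 3 → ℝ), (∀ x, |g x| ≤ 1) → ∀ x : ZSite 3,
        |xiOf ℓ k * GxiL ℓ k a m2 x x * g x - xiOf ℓ k * Cxi 3 (xiOf ℓ k) 0 * g x| ≤ C * xiOf ℓ k := by
  obtain ⟨C, hC, HA⟩ := abs_eta_mul_GxiL_diag_sub_le hℓ amin aplus m2plus ha
  refine ⟨C, hC, fun k hk a m2 ha1 ha2 hm1 hm2 g hg x => ?_⟩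
  rw [← sub_mul, abs_mul]
  calc |xiOf ℓ k * GxiL ℓ k a m2 x x - xiOf ℓ k * Cxi 3 (xiOf ℓ k) 0| * |g x| ≤ C * xiOf ℓ k * 1 :=
        mul_le_mul (HA k hk a m2 ha1 ha2 hm1 hm2 x) (hg x) (abs_nonneg _) (by positivity [(xiOf_pos ℓ k).le])
    _ = C * xiOf ℓ k := mul_one _

end

end Literature.MathematicalPhysics.QuantumFieldTheory.Balaban1983to89.B3GkTadpoleLimitZeroLattice
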